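import Summits.ValiantsHypothesis.ValiantsHypothesis.Theorems.DivisionGapPerDivisionHardStubSparseRigid

/-!
# Crux `DivisionGap.PerDivisionHard` (stmt-ValiantsHypothesis-5065), line `pair-descent-jss-endpoint` —
the admissible cone with DIAGONAL padding: placement-free penalties cut out the placed face

The registered stubs of the line cut out a placed block face `G = placedBlock eR eC`
(`G(b,k) ⊕ M₀`, `Theorems/DivisionGapDefs.lean`) with the generic weight (`stub_genericCut`: `W` on
`G`, `W - B^{rank e}` off `G`), whose penalty vanishes on the padding matching `M₀`.  Since the
padding matching of a placement meets every cell with probability `≈ 1/n`, the decisions of such a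
weight on a sparse factor depend on the placement through the padding.  The refuter's
characterisation of the admissible cone (memo `NegativeNotes-stub_noCheapOmnipresence.md`, A1:
penalties vanish on the BLOCK edges; each padding edge carries a free constant) allows a better
choice, recorded here (dossier v3 §2, `Lines/pair-descent-jss-endpoint-k2-dossier-v3.md`):

* place block rows and block columns so that the padding matching is the DIAGONAL (`eR` and `eC`
  agree on the padding labels);
* take ANY penalty `q` that vanishes on the non-padding cells of `G`, is positive on the diagonal
  window cells outside `G`, and charges every off-diagonal cell outside `G` more than all diagonal
  cells together (e.g. `q = p̃ · 𝟙[e ∉ Block]` for a placement-free `p̃` with tiny diagonal values).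

`cutsOut_diagPenalty`: the weight `W - q` cuts out `G`.  `penalty_le_of_mem_support_topComponent`:
its top fibre on a polynomial with monomials of equal degree consists of penalty minimisers.  So for
torus-homogeneous `h` the fibre is `argmin_{supp h} q`, and a factor's decision differs from the
placement-free one only if the factor's difference support meets the BLOCK (probability
`≈ |Z|(2k+1)b²/n²`), never because of the padding.
-/

noncomputable section

-- `Summit.ValiantsHypothesis.ValiantsHypothesis.…` is the tree's mandated single-conjunct layout
-- (Sub = Summit), so the duplicated namespace component is intended.
set_option linter.dupNamespace false

namespace Summit.ValiantsHypothesis.ValiantsHypothesis.Theorems.DivisionGapPerDivisionHard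

open MvPolynomial Literature.Computability.AlgebraicComplexity
open Summit.ValiantsHypothesis.ValiantsHypothesis.Theorems.ZeroOneTransfer.Negative
  (topComponent coeff_topComponent)
open scoped NNReal

variable {b k m n : ℕ}

/-- Neighbours of a padding column: its own padding row only. [folklore] -/
theorem adj_paddingCol {u : Fin m} {r : BlockV b k m}
    (hr : blockAdj b k m r (Sum.inr (Sum.inr u)) = true) : r = Sum.inr (Sum.inr u) := by
  rcases r with i | ⟨i, j, t⟩ | u'
  · simp [blockAdj] at hr
  · simp [blockAdj] at hr
  · simp only [blockAdj, decide_eq_true_eq] at hr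
    rw [hr]

/-- In a placed block graph, a cell of `G` in a padding column is the padding cell of that column.
[folklore] -/
theorem eq_pad_of_mem_placedBlock_col (eR eC : BlockV b k m ≃ Fin n) {r : Fin n} {u : Fin m}
    (h : (r, eC (Sum.inr (Sum.inr u))) ∈ placedBlock eR eC) : r = eR (Sum.inr (Sum.inr u)) := by
  simp only [placedBlock, Finset.mem_filter, Finset.mem_univ, true_and, Equiv.symm_apply_apply] at h
  have := adj_paddingCol h
  rw [← this, Equiv.apply_symm_apply]

/-- In a placed block graph, a cell of `G` in a padding row is the padding cell of that row.
[folklore] -/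
theorem eq_pad_of_mem_placedBlock_row (eR eC : BlockV b k m ≃ Fin n) {c : Fin n} {u : Fin m}
    (h : (eR (Sum.inr (Sum.inr u)), c) ∈ placedBlock eR eC) : c = eC (Sum.inr (Sum.inr u)) := by
  simp only [placedBlock, Finset.mem_filter, Finset.mem_univ, true_and, Equiv.symm_apply_apply] at h
  have := adj_paddingRow h
  rw [← this, Equiv.apply_symm_apply]

section Diag

variable (eR eC : BlockV b k m ≃ Fin n) (q : Fin n × Fin n → ℕ)
  (hdiag : ∀ u, eR (Sum.inr (Sum.inr u)) = eC (Sum.inr (Sum.inr u)))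
  (hfree : ∀ e ∈ placedBlock eR eC, (∀ u, e.1 ≠ eR (Sum.inr (Sum.inr u))) → q e = 0)
  (hbig : ∀ e, e.1 ≠ e.2 → e ∉ placedBlock eR eC → (∑ r, q (r, r)) < q e)
  (hpos : ∀ r, (r, r) ∉ placedBlock eR eC → 0 < q (r, r))

include hdiag in
/-- With diagonal padding the padding penalty is a sub-sum of the diagonal penalties. [folklore] -/
theorem padPenalty_le_sum_diag :
    (∑ u : Fin m, q (eR (Sum.inr (Sum.inr u)), eC (Sum.inr (Sum.inr u)))) ≤ ∑ r, q (r, r) := by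
  classical
  have hinj : Function.Injective fun u : Fin m => eR (Sum.inr (Sum.inr u)) := fun u v huv => by
    simpa using huv
  calc ∑ u : Fin m, q (eR (Sum.inr (Sum.inr u)), eC (Sum.inr (Sum.inr u)))
      = ∑ u : Fin m, q (eR (Sum.inr (Sum.inr u)), eR (Sum.inr (Sum.inr u))) := by
        refine Finset.sum_congr rfl fun u _ => ?_
        rw [hdiag u]
    _ = ∑ r ∈ (Finset.univ : Finset (Fin m)).image fun u => eR (Sum.inr (Sum.inr u)), q (r, r) := by
        rw [Finset.sum_image fun u _ v _ huv => hinj huv]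
    _ ≤ ∑ r, q (r, r) :=
        Finset.sum_le_sum_of_subset_of_nonneg (Finset.subset_univ _) fun _ _ _ => Nat.zero_le _

include hfree in
/-- A permutation inside `G` pays exactly the padding penalty. [folklore] -/
theorem permPenalty_eq_of_subset {σ : Equiv.Perm (Fin n)} (hσ : ∀ x, (σ x, x) ∈ placedBlock eR eC) :
    (∑ x, q (σ x, x)) = (∑ u : Fin m, q (eR (Sum.inr (Sum.inr u)), eC (Sum.inr (Sum.inr u)))) := by
  classical
  -- split the columns along the labelling `eC`
  rw [← Equiv.sum_comp eC (fun x => q (σ x, x))]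
  rw [Fintype.sum_sum_type, Fintype.sum_sum_type]
  -- core and internal columns: their `σ`-cell is a non-padding-row cell of `G`, hence free
  have hcore : ∀ ℓ : BlockV b k m, (∀ u, ℓ ≠ Sum.inr (Sum.inr u)) → q (σ (eC ℓ), eC ℓ) = 0 := by
    intro ℓ hℓ
    refine hfree _ (hσ (eC ℓ)) fun u hu => ?_
    -- if the row were a padding row, the column would be its padding column
    have hmem := hσ (eC ℓ)
    rw [show (σ (eC ℓ), eC ℓ) = (eR (Sum.inr (Sum.inr u)), eC ℓ) from Prod.ext hu rfl] at hmem
    have := eq_pad_of_mem_placedBlock_row eR eC hmem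
    exact hℓ u (eC.injective this)
  have h1 : ∑ i : Fin b, q (σ (eC (Sum.inl i)), eC (Sum.inl i)) = 0 :=
    Finset.sum_eq_zero fun i _ => hcore _ fun u => by simp
  have h2 : ∑ p : Fin b × Fin b × Fin k, q (σ (eC (Sum.inr (Sum.inl p))), eC (Sum.inr (Sum.inl p))) = 0 :=
    Finset.sum_eq_zero fun p _ => hcore _ fun u => by simp
  rw [h1, h2, zero_add, zero_add]
  -- padding columns: the `σ`-cell is the padding cell
  refine Finset.sum_congr rfl fun u _ => ?_
  have := eq_pad_of_mem_placedBlock_col eR eC (hσ (eC (Sum.inr (Sum.inr u))))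
  rw [this]

include hdiag hbig hpos in
/-- A permutation NOT inside `G` pays strictly more than the padding penalty. [folklore] -/
theorem padPenalty_lt_permPenalty {τ : Equiv.Perm (Fin n)} (hτ : ∃ x, (τ x, x) ∉ placedBlock eR eC) :
    (∑ u : Fin m, q (eR (Sum.inr (Sum.inr u)), eC (Sum.inr (Sum.inr u)))) < ∑ x, q (τ x, x) := by
  classical
  by_cases hoff : ∃ x, (τ x, x) ∉ placedBlock eR eC ∧ τ x ≠ x
  · -- an off-diagonal off-`G` cell: it alone costs more than all diagonal cells
    obtain ⟨x, hx, hne⟩ := hoff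
    calc (∑ u : Fin m, q (eR (Sum.inr (Sum.inr u)), eC (Sum.inr (Sum.inr u))))
        ≤ ∑ r, q (r, r) := padPenalty_le_sum_diag eR eC q hdiag
      _ < q (τ x, x) := hbig _ hne hx
      _ ≤ ∑ y, q (τ y, y) :=
          Finset.single_le_sum (f := fun y => q (τ y, y)) (fun y _ => Nat.zero_le (q (τ y, y)))
            (Finset.mem_univ x)
  · -- all off-`G` cells of `τ` are diagonal
    push Not at hoff
    obtain ⟨x₀, hx₀⟩ := hτ
    have hx₀d : τ x₀ = x₀ := hoff x₀ hx₀
    -- padding columns are fixed by `τ` and carry the padding cell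
    have hpadfix : ∀ u, τ (eC (Sum.inr (Sum.inr u))) = eR (Sum.inr (Sum.inr u)) := by
      intro u
      by_cases hmem : (τ (eC (Sum.inr (Sum.inr u))), eC (Sum.inr (Sum.inr u))) ∈ placedBlock eR eC
      · exact eq_pad_of_mem_placedBlock_col eR eC hmem
      · rw [hoff _ hmem, ← hdiag u]
    -- compare the two sums column by column along `eC`
    rw [← Equiv.sum_comp eC (fun x => q (τ x, x)), Fintype.sum_sum_type, Fintype.sum_sum_type]
    have hpad : ∑ u : Fin m, q (τ (eC (Sum.inr (Sum.inr u))), eC (Sum.inr (Sum.inr u))) =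
        ∑ u : Fin m, q (eR (Sum.inr (Sum.inr u)), eC (Sum.inr (Sum.inr u))) :=
      Finset.sum_congr rfl fun u _ => by rw [hpadfix u]
    rw [hpad]
    -- the bad column `x₀` is a core or internal column and contributes a positive diagonal penalty
    have hx₀pos : 0 < q (τ x₀, x₀) := by
      rw [hx₀d]
      rw [hx₀d] at hx₀
      exact hpos x₀ hx₀
    have hx₀pos' : 0 < q (τ (eC (eC.symm x₀)), eC (eC.symm x₀)) := by
      simpa using hx₀pos
    have hx₀npad : ∀ u, x₀ ≠ eC (Sum.inr (Sum.inr u)) := by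
      intro u hu
      apply hx₀
      rw [hu, hpadfix u]
      simpa [placedBlock] using (show blockAdj b k m (Sum.inr (Sum.inr u)) (Sum.inr (Sum.inr u)) = true by
        simp [blockAdj])
    -- locate `x₀` among the core/internal columns
    obtain ⟨ℓ₀, hℓ₀⟩ := eC.surjective x₀
    have hsum_pos : 0 < (∑ i : Fin b, q (τ (eC (Sum.inl i)), eC (Sum.inl i))) +
        ∑ p : Fin b × Fin b × Fin k, q (τ (eC (Sum.inr (Sum.inl p))), eC (Sum.inr (Sum.inl p))) := by
      rcases ℓ₀ with i | p | u
      · have : q (τ (eC (Sum.inl i)), eC (Sum.inl i)) ≤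
            ∑ i : Fin b, q (τ (eC (Sum.inl i)), eC (Sum.inl i)) :=
          Finset.single_le_sum (f := fun i : Fin b => q (τ (eC (Sum.inl i)), eC (Sum.inl i)))
            (fun y _ => Nat.zero_le _) (Finset.mem_univ i)
        rw [hℓ₀] at this
        omega
      · have : q (τ (eC (Sum.inr (Sum.inl p))), eC (Sum.inr (Sum.inl p))) ≤
            ∑ p : Fin b × Fin b × Fin k, q (τ (eC (Sum.inr (Sum.inl p))), eC (Sum.inr (Sum.inl p))) :=
          Finset.single_le_sum
            (f := fun p : Fin b × Fin b × Fin k => q (τ (eC (Sum.inr (Sum.inl p))), eC (Sum.inr (Sum.inl p))))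
            (fun y _ => Nat.zero_le _) (Finset.mem_univ p)
        rw [hℓ₀] at this
        omega
      · exact absurd hℓ₀.symm (hx₀npad u)
    omega

include hdiag hfree hbig hpos in
/-- Placement-free penalties with diagonal padding cut out the placed face (section form of
`cutsOut_diagPenalty`). [folklore] -/
theorem cutsOut_diagPenalty_of (hk : 0 < k) {W : ℕ} (hW : ∀ e, q e ≤ W) :
    CutsOut (fun e => W - q e) (placedBlock eR eC) := by
  classical
  -- the weight of a permutation is `n·W - penalty`
  have hwt : ∀ τ : Equiv.Perm (Fin n), ∑ x, (W - q (τ x, x)) + ∑ x, q (τ x, x) = n * W := by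
    intro τ
    rw [← Finset.sum_add_distrib, Finset.sum_congr rfl fun x _ => Nat.sub_add_cancel (hW (τ x, x))]
    simp
  obtain ⟨g, hg⟩ := exists_blockMatching b k m hk
  obtain ⟨σ₀, hσ₀⟩ := exists_perm_mem_placedBlock eR eC g hg
  have hP : ∀ τ : Equiv.Perm (Fin n),
      (∑ u : Fin m, q (eR (Sum.inr (Sum.inr u)), eC (Sum.inr (Sum.inr u)))) ≤ ∑ x, q (τ x, x) := by
    intro τ
    by_cases hτ : ∀ x, (τ x, x) ∈ placedBlock eR eC
    · exact (permPenalty_eq_of_subset eR eC q hfree hτ).ge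
    · push Not at hτ
      exact (padPenalty_lt_permPenalty eR eC q hdiag hbig hpos hτ).le
  intro σ
  constructor
  · intro hσ τ
    show (∑ i, (W - q (τ i, i))) ≤ ∑ i, (W - q (σ i, i))
    have h1 := hwt σ
    have h2 := hwt τ
    have h3 := permPenalty_eq_of_subset eR eC q hfree hσ
    have h4 := hP τ
    omega
  · intro hmax
    by_contra hno
    push Not at hno
    have h1 := hwt σ
    have h2 := hwt σ₀
    have h3 := permPenalty_eq_of_subset eR eC q hfree hσ₀
    have h4 := padPenalty_lt_permPenalty eR eC q hdiag hbig hpos hno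
    have h5 : (∑ i, (W - q (σ₀ i, i))) ≤ ∑ i, (W - q (σ i, i)) := hmax σ₀
    omega

end Diag

/-- **Placement-free penalties with diagonal padding cut out the placed face** (registered
sub-goal of crux stmt-ValiantsHypothesis-5065, line `pair-descent-jss-endpoint`, dossier v3 §2).
If `k ≥ 1`, the padding of the placement `eR, eC` of `G(b,k) ⊕ M₀` is diagonal, the penalty `q`
vanishes on the non-padding cells of `G = placedBlock eR eC`, charges every off-diagonal cell
outside `G` more than all diagonal cells together, is positive on the diagonal cells outside `G`,
and `q ≤ W`, then the weight `W - q` cuts out `G`. -/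
theorem cutsOut_diagPenalty :
    ∀ (b k m n : ℕ) (eR eC : BlockV b k m ≃ Fin n) (q : Fin n × Fin n → ℕ) (W : ℕ), 0 < k →
      (∀ u, eR (Sum.inr (Sum.inr u)) = eC (Sum.inr (Sum.inr u))) →
      (∀ e ∈ placedBlock eR eC, (∀ u, e.1 ≠ eR (Sum.inr (Sum.inr u))) → q e = 0) →
      (∀ e, e.1 ≠ e.2 → e ∉ placedBlock eR eC → (∑ r, q (r, r)) < q e) →
      (∀ r, (r, r) ∉ placedBlock eR eC → 0 < q (r, r)) →
      (∀ e, q e ≤ W) → CutsOut (fun e => W - q e) (placedBlock eR eC) :=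
  fun _ _ _ _ eR eC q _ hk hdiag hfree hbig hpos hW =>
    cutsOut_diagPenalty_of eR eC q hdiag hfree hbig hpos hk hW

/-! ### The top fibre of a penalty weight: penalty minimisers -/

/-- Weight plus penalty is `W · deg` for the weight `W - q` (`q ≤ W`). [folklore] -/
theorem weight_add_penalty (q : Fin n × Fin n → ℕ) {W : ℕ} (hW : ∀ e, q e ≤ W)
    (m : (Fin n × Fin n) →₀ ℕ) :
    Finsupp.weight (fun e => W - q e) m + ∑ e, q e * m e = W * m.degree := by
  rw [Finsupp.weight_apply, Finsupp.sum_fintype m (fun i c => c • (W - q i)) (fun _ => zero_smul _ _),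
    ← Finset.sum_add_distrib, Finsupp.degree_eq_sum, Finset.mul_sum]
  refine Finset.sum_congr rfl fun e _ => ?_
  rw [smul_eq_mul, mul_comm (q e), ← mul_add, Nat.sub_add_cancel (hW e), mul_comm]

/-- **The top fibre of `W - q` minimises the penalty** among monomials of the same degree: if `m₁`
lies in the top fibre and `m₂ ∈ supp h` has the same degree, then `Σ q·m₁ ≤ Σ q·m₂`.
(For torus-homogeneous `h` all monomials have the same degree, so the fibre is `argmin penalty`.)
[folklore] -/
theorem penalty_le_of_mem_support_topComponent (q : Fin n × Fin n → ℕ) {W : ℕ} (hW : ∀ e, q e ≤ W)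
    {h : MvPolynomial (Fin n × Fin n) ℝ≥0} {m₁ m₂ : (Fin n × Fin n) →₀ ℕ}
    (hm₁ : m₁ ∈ (topComponent (fun e => W - q e) h).support) (hm₂ : m₂ ∈ h.support)
    (hdeg : m₁.degree = m₂.degree) : ∑ e, q e * m₁ e ≤ ∑ e, q e * m₂ e := by
  have hw₁ : Finsupp.weight (fun e => W - q e) m₁ = weightedTotalDegree (fun e => W - q e) h := by
    have := mem_support_iff.mp hm₁
    rw [coeff_topComponent] at this
    by_contra hne
    exact this (if_neg hne)
  have hw₂ : Finsupp.weight (fun e => W - q e) m₂ ≤ weightedTotalDegree (fun e => W - q e) h :=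
    le_weightedTotalDegree _ hm₂
  have e₁ := weight_add_penalty q hW m₁
  have e₂ := weight_add_penalty q hW m₂
  rw [hdeg] at e₁
  omega

end Summit.ValiantsHypothesis.ValiantsHypothesis.Theorems.DivisionGapPerDivisionHard

end
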